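import Summits.Ventures.KdS.RouteWDoublyResonantComparison
import HarnessLib

/-!
# Venture KdS — the doubly-resonant candidates, IV: T10's truncated recurrence matrix (1.1) is in
# the class of Lemma A

HONEST FRAMING (venture `Summits/Ventures/KdS`, cell `pub-kds`; optional kernel object of the
Monday S3 seat; companion of `RouteWDoublyResonantComparison` (Lemma A),
`RouteWDoublyResonantVieta` (Lemma B) and `RouteWDoublyResonantDictionary` (the tree-side glue)).
T10 (`lit/Q3PRIME-CASES.md` (1.1)): after the F-homotopy and the polynomial truncation of Heun's
equation at `x = 0`, the transformed accessory parameter `q′` of a degree-`d` polynomial candidate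
is an eigenvalue of the real tridiagonal `(d+1) × (d+1)` matrix
`A_{ii} = D_i := i[(i−1+γ)(1+t) + δt + ε′]`, `A_{i,i+1} = −t(i+1)(i+γ)`, `A_{i+1,i} = (i+α′)(d−i)`.
This file DEFINES that matrix (`truncMatrix`) and proves that it lies in the class of Lemma A as
soon as `t ≥ 1`, `γ > 0`, `δ ≥ 0`, `α′ > 0`, `2γ + δ + ε′ ≥ 0` (`truncMatrix_band`,
`truncMatrix_prod_neg`, `truncDiag_nonneg`), hence every eigen-relation with `v ≠ 0` has
`0 ≤ Re q′`, and `0 < Re q′` for `d ≥ 1` (`truncMatrix_eigenvalue_re_nonneg`,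
`truncMatrix_eigenvalue_re_pos`); and that T10's
parameters meet these conditions: `t = z_r > 1` on subextremal Kerr–de Sitter (the tree's
`KerrDeSitter.one_lt_mobiusZr`, Hatsuda's `z_r = z(r_n)`), and `γ = 2 + i₀`,
`δ = j + 1 = s + u + 1`, `ε′ = 2 − ε = 1 − s + u·b_n`, `α′ = σ₊ + (1 − ε) = s + 1 + u·b_n` with
`s ≥ 0`, `u > 0`, `b_n > 0`, `i₀ ≥ 0`
(`truncMatrixT10_eigenvalue_re_nonneg`). Together with `re_lambdaBar_neg_of_re_nonneg` of the
Dictionary file this is T10's theorem for every candidate whose `q′` is an eigenvalue of (1.1); the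
derivation of (1.1) itself from Heun's equation (generic bookkeeping) is NOT typed here. Nothing in
this file is a statement about `NonExtremeStrata`, H3, or the Final State Conjecture. 0 cited facts,
no `sorry`.
-/

noncomputable section

open Complex Finset

namespace Summit.Ventures.KdS.RouteW.DoublyResonant

/-! ### §1. The matrix (1.1) -/

/-- The diagonal `D_i := i[(i−1+γ)(1+t) + δt + ε′]` of T10 (1.1) (so `D_0 = 0`). -/
def truncDiag (t γ δ ε' : ℝ) (i : ℕ) : ℝ :=
  (i : ℝ) * (((i : ℝ) - 1 + γ) * (1 + t) + δ * t + ε')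

/-- T10's truncated recurrence matrix (1.1) on `Fin (d+1)`:
`A_{ii} = D_i`, `A_{i,i+1} = −t(i+1)(i+γ)`, `A_{i+1,i} = (i+α′)(d−i)`, all other entries `0`. -/
def truncMatrix (t γ δ ε' α' : ℝ) (d : ℕ) : Matrix (Fin (d + 1)) (Fin (d + 1)) ℝ :=
  fun i j =>
    if (j : ℕ) = i then truncDiag t γ δ ε' i
    else if (j : ℕ) = i + 1 then -(t * ((i : ℝ) + 1) * ((i : ℝ) + γ))
    else if (i : ℕ) = j + 1 then ((j : ℝ) + α') * ((d : ℝ) - j)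
    else 0

variable {t γ δ ε' α' : ℝ} {d : ℕ}

/-- (1.1) is tridiagonal. -/
theorem truncMatrix_band (i j : Fin (d + 1)) (h : (i : ℕ) + 1 < j ∨ (j : ℕ) + 1 < i) :
    truncMatrix t γ δ ε' α' d i j = 0 := by
  unfold truncMatrix
  split_ifs with h1 h2 h3
  · exfalso; omega
  · exfalso; omega
  · exfalso; omega
  · rfl

/-- The diagonal entries of (1.1). -/
theorem truncMatrix_diag (i : Fin (d + 1)) :
    truncMatrix t γ δ ε' α' d i i = truncDiag t γ δ ε' i := by
  unfold truncMatrix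
  rw [if_pos rfl]

/-- The super-diagonal entries `A_{i,i+1} = −t(i+1)(i+γ)`. -/
theorem truncMatrix_super (i j : Fin (d + 1)) (h : (j : ℕ) = i + 1) :
    truncMatrix t γ δ ε' α' d i j = -(t * ((i : ℝ) + 1) * ((i : ℝ) + γ)) := by
  unfold truncMatrix
  rw [if_neg (by omega), if_pos h]

/-- The sub-diagonal entries `A_{i+1,i} = (i+α′)(d−i)`. -/
theorem truncMatrix_sub (i j : Fin (d + 1)) (h : (j : ℕ) = i + 1) :
    truncMatrix t γ δ ε' α' d j i = (((i : ℕ) : ℝ) + α') * ((d : ℝ) - ((i : ℕ) : ℝ)) := by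
  unfold truncMatrix
  rw [if_neg (by omega), if_neg (by omega), if_pos h]

/-- **Negative off-diagonal products** (T10 §2: "`A_{i,i+1}A_{i+1,i} = −t(i+1)(i+γ)(i+α′)(d−i)` are
strictly NEGATIVE"), for `t > 0`, `γ > 0`, `α′ > 0`. -/
theorem truncMatrix_prod_neg (ht : 0 < t) (hγ : 0 < γ) (hα : 0 < α') (i j : Fin (d + 1))
    (h : (j : ℕ) = i + 1) :
    truncMatrix t γ δ ε' α' d i j * truncMatrix t γ δ ε' α' d j i < 0 := by
  rw [truncMatrix_super i j h, truncMatrix_sub i j h]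
  have hj := j.2
  have hid : ((i : ℕ) : ℝ) < d := by exact_mod_cast (show (i : ℕ) < d by omega)
  have hi0 : (0 : ℝ) ≤ ((i : ℕ) : ℝ) := Nat.cast_nonneg _
  have h1 : 0 < t * ((i : ℝ) + 1) * ((i : ℝ) + γ) := by positivity
  have h2 : 0 < (((i : ℕ) : ℝ) + α') * ((d : ℝ) - ((i : ℕ) : ℝ)) :=
    mul_pos (by linarith) (by linarith)
  exact mul_neg_of_neg_of_pos (neg_neg_of_pos h1) h2

/-- **Nonnegative diagonal** (T10 §2: `D_0 = 0`, `D_i > 0` for `i ≥ 1`): for `t ≥ 1`, `γ ≥ 0`,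
`δ ≥ 0` and `2γ + δ + ε′ ≥ 0` every `D_i ≥ 0`, since `(i−1+γ)(1+t) + δt + ε′ ≥ 2γ + δ + ε′`. -/
theorem truncDiag_nonneg (ht : 1 ≤ t) (hγ : 0 ≤ γ) (hδ : 0 ≤ δ) (hsum : 0 ≤ 2 * γ + δ + ε')
    (i : ℕ) : 0 ≤ truncDiag t γ δ ε' i := by
  unfold truncDiag
  rcases Nat.eq_zero_or_pos i with h0 | hpos
  · subst h0; simp
  · have hi1 : (1 : ℝ) ≤ (i : ℝ) := by exact_mod_cast hpos
    apply mul_nonneg (by linarith)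
    nlinarith [mul_nonneg (sub_nonneg.2 hi1) (show (0 : ℝ) ≤ 1 + t by linarith),
      mul_nonneg hγ (sub_nonneg.2 ht), mul_nonneg hδ (sub_nonneg.2 ht)]

/-- Strictly positive diagonal past index `0` when `2γ + δ + ε′ > 0`. -/
theorem truncDiag_pos (ht : 1 ≤ t) (hγ : 0 ≤ γ) (hδ : 0 ≤ δ) (hsum : 0 < 2 * γ + δ + ε')
    {i : ℕ} (hi : 1 ≤ i) : 0 < truncDiag t γ δ ε' i := by
  unfold truncDiag
  have hi1 : (1 : ℝ) ≤ (i : ℝ) := by exact_mod_cast hi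
  apply mul_pos (by linarith)
  nlinarith [mul_nonneg (sub_nonneg.2 hi1) (show (0 : ℝ) ≤ 1 + t by linarith),
    mul_nonneg hγ (sub_nonneg.2 ht), mul_nonneg hδ (sub_nonneg.2 ht)]

/-! ### §2. Lemma A applied to (1.1) -/

/-- **`0 ≤ Re q′` for every eigen-relation of (1.1)** (Lemma A, `tridiagonal_eigenvalue_re_nonneg`),
for `t ≥ 1`, `γ > 0`, `δ ≥ 0`, `α′ > 0`, `2γ + δ + ε′ ≥ 0`. -/
theorem truncMatrix_eigenvalue_re_nonneg (ht : 1 ≤ t) (hγ : 0 < γ) (hδ : 0 ≤ δ) (hα : 0 < α')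
    (hsum : 0 ≤ 2 * γ + δ + ε') {q : ℂ} {v : Fin (d + 1) → ℂ} (hv : v ≠ 0)
    (heig : ∀ i, ∑ j, (truncMatrix t γ δ ε' α' d i j : ℂ) * v j = q * v i) : 0 ≤ q.re :=
  tridiagonal_eigenvalue_re_nonneg (truncMatrix t γ δ ε' α' d) truncMatrix_band
    (truncMatrix_prod_neg (by linarith) hγ hα) (fun i => by
      rw [truncMatrix_diag]; exact truncDiag_nonneg ht hγ.le hδ hsum i) hv heig

/-- **`0 < Re q′` for `d ≥ 1`** (Lemma A, strict form `tridiagonal_eigenvalue_re_pos`), when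
moreover `2γ + δ + ε′ > 0`. -/
theorem truncMatrix_eigenvalue_re_pos (hd : 1 ≤ d) (ht : 1 ≤ t) (hγ : 0 < γ) (hδ : 0 ≤ δ)
    (hα : 0 < α') (hsum : 0 < 2 * γ + δ + ε') {q : ℂ} {v : Fin (d + 1) → ℂ} (hv : v ≠ 0)
    (heig : ∀ i, ∑ j, (truncMatrix t γ δ ε' α' d i j : ℂ) * v j = q * v i) : 0 < q.re :=
  tridiagonal_eigenvalue_re_pos (truncMatrix t γ δ ε' α' d) hd truncMatrix_band
    (truncMatrix_prod_neg (by linarith) hγ hα)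
    (fun i => by rw [truncMatrix_diag]; exact truncDiag_nonneg ht hγ.le hδ hsum.le i)
    (fun i hi => by rw [truncMatrix_diag]; exact truncDiag_pos ht hγ.le hδ hsum hi) hv heig

/-! ### §3. T10's parameters meet the conditions -/

/-- **T10's parameters** `γ = 2 + i₀`, `δ = s + u + 1` (`= j + 1`), `ε′ = 1 − s + u·b`,
`α′ = s + 1 + u·b` with `s ≥ 0`, `u > 0`, `b > 0`, `i₀ ≥ 0` and `t > 1`: every eigen-relation of
(1.1) with `v ≠ 0` has `0 ≤ Re q′` (and `0 < Re q′` when `d ≥ 1`). -/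
theorem truncMatrixT10_eigenvalue_re_nonneg {s u b i₀ : ℝ} (ht : 1 < t) (hs : 0 ≤ s) (hu : 0 < u)
    (hb : 0 < b) (hi : 0 ≤ i₀) {q : ℂ} {v : Fin (d + 1) → ℂ} (hv : v ≠ 0)
    (heig : ∀ i, ∑ j,
      (truncMatrix t (2 + i₀) (s + u + 1) (1 - s + u * b) (s + 1 + u * b) d i j : ℂ) * v j =
        q * v i) : 0 ≤ q.re := by
  have hub : 0 < u * b := mul_pos hu hb
  exact truncMatrix_eigenvalue_re_nonneg ht.le (by linarith) (by linarith) (by linarith)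
    (by linarith) hv heig

/-- Strict form of `truncMatrixT10_eigenvalue_re_nonneg` for `d ≥ 1` (T10 Lemma A: "`Re q′_k > 0`
when `d ≥ 1`"). -/
theorem truncMatrixT10_eigenvalue_re_pos {s u b i₀ : ℝ} (hd : 1 ≤ d) (ht : 1 < t) (hs : 0 ≤ s)
    (hu : 0 < u) (hb : 0 < b) (hi : 0 ≤ i₀) {q : ℂ} {v : Fin (d + 1) → ℂ} (hv : v ≠ 0)
    (heig : ∀ i, ∑ j,
      (truncMatrix t (2 + i₀) (s + u + 1) (1 - s + u * b) (s + 1 + u * b) d i j : ℂ) * v j =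
        q * v i) : 0 < q.re := by
  have hub : 0 < u * b := mul_pos hu hb
  exact truncMatrix_eigenvalue_re_pos hd ht.le (by linarith) (by linarith) (by linarith)
    (by linarith) hv heig

end Summit.Ventures.KdS.RouteW.DoublyResonant
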